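import Mathlib.Analysis.Calculus.Deriv.Slope
import Literature.Analysis.FluidPDE.GavrilovSteadyEuler
import Literature.Analysis.FluidPDE.GavrilovLocalisation
import Literature.Analysis.FluidPDE.GavrilovProfile
import Literature.Analysis.FluidPDE.GavrilovLocalSolution
import Literature.Analysis.FluidPDE.GavrilovAnsatz
import HarnessLib

/-!
# Proof of Gavrilov's theorem: a smooth compactly supported steady Euler flow on `ℝ³`

Topic `Literature/Analysis/FluidPDE`; this file DISCHARGES the named fact
`Literature.Analysis.FluidPDE.gavrilov_compact_steady_euler` (Gavrilov 2019, §1 Theorem, with the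
structure of the §3 construction): `theorem gavrilov_compact_steady_euler_holds`.

The proof follows Gavrilov's paper (GAFA 29 (2019) 190–197) step by step, in the smooth
category:

* §2.1 Lemma 1 (the profile `ψ`, and `H` of Lemma 2): `GavrilovProfile.lean` (explicit power
  series with a Catalan majorant), packaged here as `Gavrilov.gavrilovProfile : ProfileData`;
* §2.1 Lemma 2 and the chart `(x, α) ↦ (F, G)`: `GavrilovChart.lean`;
* §2.2 Lemma 3 (the form `κ`, `dκ = 0`, the Poincaré lemma, the solution `α`) and Lemma 4:
  `GavrilovPotential.lean`, `GavrilovLocalSolution.lean`;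
* §3, the Lemma after (4) (the ansatz solves the Euler system (3)): `GavrilovAnsatz.lean`, fed
  here with the meridian data `Gavrilov.ProfileData.ansatz` at radius `R`
  (`a = R⁴α(ρ/R, z/R)`, `c = R³√H(α(ρ/R, z/R))`, i.e. Gavrilov's `p = aR⁴/4`, `b = R³√H(a)/4` up
  to the harmless normalisation `(U, P) = (4u, 16p)`), on the punctured meridian domain where
  `0 < α < a₀` (`H > 0` on `(0, a₀)` since `H(0) = 0`, `H'(0) = 4`, `exists_profileH_pos`);
* §3, last paragraph (localisation by `ω(p)`): `GavrilovLocalisation.lean`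
  (`Gavrilov.exists_global_of_local`), applied to the germ on the tube around `𝒞_R`
  (`Gavrilov.exists_flow`).

## References

* A. V. Gavrilov, *A steady Euler flow with compact support*, Geom. Funct. Anal. 29 (2019)
  190–197 = arXiv:1810.08020, §1 Theorem, §§2–3. [`Gavrilov2019`]
* P. Constantin, J. La, V. Vicol, *Remarks on a paper by Gavrilov…*, Geom. Funct. Anal. 29
  (2019) 1773–1793, Thm 1.1. [`ConstantinLaVicol2019`]
-/

noncomputable section

open Set Filter Metric Function WithLp InnerProductSpace
open scoped Topology RealInnerProductSpace

namespace Literature.Analysis.FluidPDE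

namespace Gavrilov

/-! ### The concrete profile data -/

/-- `H = 24αψ − 20Ψ` is smooth on `(−1, 1)`. [folklore] -/
theorem contDiffOn_profileH {n : WithTop ℕ∞} : ContDiffOn ℝ n profileH (Metric.ball (0 : ℝ) 1) := by
  have h : ContDiffOn ℝ n (fun a : ℝ => 24 * a * profile a - 20 * profilePrim a) (Metric.ball (0 : ℝ) 1) :=
    ((contDiffOn_const.mul contDiffOn_id).mul contDiffOn_profile).sub
      (contDiffOn_const.mul contDiffOn_profilePrim)
  exact h

/-- **Gavrilov's profile as a `ProfileData` record**: the power-series functions `ψ`, `ψ'`,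
`H` of `GavrilovProfile.lean` (Lemma 1) have all the properties the construction uses.
[cite: Gavrilov2019, §2.1 Lemma 1, Lemma 2] -/
def gavrilovProfile : ProfileData where
  ψ := profile
  χ := profileDeriv
  H := profileH
  hasDerivAt_ψ := fun _ ha => hasDerivAt_profile ha
  hasDerivAt_H := fun _ ha => hasDerivAt_profileH ha
  contDiffOn_ψ := contDiffOn_profile
  contDiffOn_χ := contDiffOn_profileDeriv
  contDiffOn_H := contDiffOn_profileH
  H_mul_χ := fun _ ha => profileH_mul_profileDeriv ha
  ψ_zero := profile_zero
  χ_zero := profileDeriv_zero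
  H_zero := profileH_zero

/-- `H > 0` on a right neighbourhood `(0, a₀)` of `0` (`H(0) = 0`, `H'(0) = 4`): the swirl
`b = R³√H(a)/4` of (4) is real and nonzero off the circle. [cite: Gavrilov2019, §3 (4)] -/
theorem exists_profileH_pos : ∃ a₀ : ℝ, 0 < a₀ ∧ ∀ a : ℝ, 0 < a → a < a₀ → 0 < profileH a := by
  have h := hasDerivAt_profileH_zero
  rw [hasDerivAt_iff_tendsto_slope] at h
  have hev : ∀ᶠ a in 𝓝[≠] (0 : ℝ), (2 : ℝ) < slope profileH 0 a :=
    h.eventually (lt_mem_nhds (by norm_num))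
  rw [eventually_nhdsWithin_iff, Metric.eventually_nhds_iff] at hev
  obtain ⟨ε, hε, hball⟩ := hev
  refine ⟨min ε 1 / 2, by positivity, fun a ha0 ha => ?_⟩
  have haε : a < ε := by
    have : min ε 1 ≤ ε := min_le_left _ _
    linarith
  have hs := hball (y := a) (by rwa [dist_zero_right, Real.norm_eq_abs, abs_of_pos ha0]) ha0.ne'
  rw [slope_def_field, profileH_zero, sub_zero, sub_zero, lt_div_iff₀ ha0] at hs
  linarith

/-! ### The meridian data at radius `R` -/

namespace ProfileData

variable (D : ProfileData)

/-- The meridian domain at radius `1`, punctured at the circle point `(1, 0)`: points of the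
solution domain with `0 < x`, `α < a₀`, and `≠ (1, 0)`. [folklore] -/
def merDom (a₀ : ℝ) : Set (ℝ × ℝ) := D.locDom ∩ D.alpha ⁻¹' Iio a₀ ∩ {q | 0 < q.1}

variable {D}

/-- The meridian domain is open. [folklore] -/
theorem isOpen_merDom (a₀ : ℝ) : IsOpen (D.merDom a₀) :=
  (continuousOn_alpha.isOpen_inter_preimage isOpen_locDom isOpen_Iio).inter
    (isOpen_lt continuous_const continuous_fst)

/-- `(1, 0)` lies in the meridian domain. [folklore] -/
theorem one_zero_mem_merDom {a₀ : ℝ} (ha₀ : 0 < a₀) : ((1 : ℝ), (0 : ℝ)) ∈ D.merDom a₀ :=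
  ⟨⟨one_zero_mem_locDom, by simpa using ha₀⟩, by simp⟩

end ProfileData

/-- The rescaling `q ↦ q / R` of the meridian half-plane. [folklore] -/
def rescale (R : ℝ) (q : ℝ × ℝ) : ℝ × ℝ := (R⁻¹ * q.1, R⁻¹ * q.2)

/-- Derivative of the rescaling. [folklore] -/
theorem hasFDerivAt_rescale (R : ℝ) (q : ℝ × ℝ) : HasFDerivAt (rescale R) (M R⁻¹ 0 0 R⁻¹) q := by
  have h1 : HasFDerivAt (fun n : ℝ × ℝ => R⁻¹ * n.1) (L R⁻¹ 0) q := by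
    simpa using hasFDerivAt_comp_fst (f := fun t => R⁻¹ * t) ((hasDerivAt_id q.1).const_mul R⁻¹)
  have h2 : HasFDerivAt (fun n : ℝ × ℝ => R⁻¹ * n.2) (L 0 R⁻¹) q := by
    simpa using hasFDerivAt_comp_snd (f := fun t => R⁻¹ * t) ((hasDerivAt_id q.2).const_mul R⁻¹)
  exact h1.prodMk h2

/-- The rescaling is smooth. [folklore] -/
theorem contDiff_rescale (R : ℝ) {n : WithTop ℕ∞} : ContDiff ℝ n (rescale R) :=
  (contDiff_const.mul contDiff_fst).prodMk (contDiff_const.mul contDiff_snd)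

/-- **Chain rule for rescaled meridian functions**: if `Df(q/R) = a dx + b dy` then
`D(c · f(·/R))(q) = (c a / R) dρ + (c b / R) dz`. [folklore] -/
theorem hasFDerivAt_rescale_comp {f : ℝ × ℝ → ℝ} {a b c R : ℝ} {q : ℝ × ℝ}
    (hf : HasFDerivAt f (L a b) (rescale R q)) :
    HasFDerivAt (fun q' => c * f (rescale R q'))
      ((c * a * R⁻¹) • ContinuousLinearMap.fst ℝ ℝ ℝ + (c * b * R⁻¹) • ContinuousLinearMap.snd ℝ ℝ ℝ) q := by
  have h := (hf.comp q (hasFDerivAt_rescale R q)).const_mul c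
  refine h.congr_fderiv ?_
  ext <;> simp <;> ring

namespace ProfileData

variable (D : ProfileData)

/-- **The meridian data of the ansatz (4) at radius `R`**, from the local solution `α`:
`a(ρ, z) = R⁴ α(ρ/R, z/R)`, its partials, the swirl profile `c = R³ √H(α(ρ/R, z/R))`
(Gavrilov's `p = aR⁴/4`, `b = R³√H(a)/4`, times `16` resp. `4`). [cite: Gavrilov2019, §3 (4)] -/
def ansatz {R a₀ : ℝ} (hR : 0 < R) (hH : ∀ a : ℝ, 0 < a → a < a₀ → 0 < D.H a) :
    AnsatzData where
  W := rescale R ⁻¹' (D.merDom a₀ \ {((1 : ℝ), (0 : ℝ))})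
  isOpen_W := ((isOpen_merDom a₀).sdiff isClosed_singleton).preimage (contDiff_rescale R (n := 0)).continuous
  W_pos := fun q hq => by
    have h : 0 < R⁻¹ * q.1 := hq.1.2
    have := mul_pos hR h
    rwa [← mul_assoc, mul_inv_cancel₀ hR.ne', one_mul] at this
  a := fun q => R ^ 4 * D.alpha (rescale R q)
  ax := fun q => R ^ 3 * D.alphaX (rescale R q)
  ay := fun q => R ^ 3 * D.alphaY (rescale R q)
  axx := fun q => R ^ 2 * D.alphaXX (rescale R q)
  axy := fun q => R ^ 2 * D.alphaXY (rescale R q)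
  ayy := fun q => R ^ 2 * D.alphaYY (rescale R q)
  c := fun q => R ^ 3 * Real.sqrt (D.H (D.alpha (rescale R q)))
  cx := fun q => R ^ 2 * (D.gH' (D.alpha (rescale R q)) / (2 * Real.sqrt (D.H (D.alpha (rescale R q)))) *
    D.alphaX (rescale R q))
  cy := fun q => R ^ 2 * (D.gH' (D.alpha (rescale R q)) / (2 * Real.sqrt (D.H (D.alpha (rescale R q)))) *
    D.alphaY (rescale R q))
  hasFDerivAt_a := fun q hq => by
    have h := hasFDerivAt_rescale_comp (c := R ^ 4) (hasFDerivAt_alpha hq.1.1.1)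
    refine h.congr_fderiv ?_
    have hR' : R ≠ 0 := hR.ne'
    congr 1 <;> [congr 1; congr 1] <;> field_simp
  hasFDerivAt_ax := fun q hq => by
    have h := hasFDerivAt_rescale_comp (c := R ^ 3) (hasFDerivAt_alphaX hq.1.1.1)
    refine h.congr_fderiv ?_
    have hR' : R ≠ 0 := hR.ne'
    congr 1 <;> [congr 1; congr 1] <;> field_simp
  hasFDerivAt_ay := fun q hq => by
    have h := hasFDerivAt_rescale_comp (c := R ^ 3) (hasFDerivAt_alphaY hq.1.1.1)
    refine h.congr_fderiv ?_
    have hR' : R ≠ 0 := hR.ne'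
    congr 1 <;> [congr 1; congr 1] <;> field_simp
  hasFDerivAt_c := fun q hq => by
    have hm : rescale R q ∈ D.locDom := hq.1.1.1
    have hpos : 0 < D.alpha (rescale R q) := alpha_pos hm hq.2
    have hlt : D.alpha (rescale R q) < a₀ := hq.1.1.2
    have hHpos : 0 < D.H (D.alpha (rescale R q)) := hH _ hpos hlt
    have habs : |D.alpha (rescale R q)| < 1 := abs_alpha_lt hm
    have h1 : HasDerivAt (fun t => Real.sqrt (D.H t))
        (D.gH' (D.alpha (rescale R q)) / (2 * Real.sqrt (D.H (D.alpha (rescale R q)))))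
        (D.alpha (rescale R q)) :=
      (D.hasDerivAt_H _ habs).sqrt hHpos.ne'
    have h2 := h1.comp_hasFDerivAt (rescale R q) (hasFDerivAt_alpha hm)
    have h3 := (h2.comp q (hasFDerivAt_rescale R q)).const_mul (R ^ 3)
    refine h3.congr_fderiv ?_
    have hR' : R ≠ 0 := hR.ne'
    ext <;> simp [gH'] <;> field_simp
  contDiffOn_a := contDiffOn_const.mul
    (contDiffOn_alpha.comp (contDiff_rescale R).contDiffOn fun q hq => hq.1.1.1)
  contDiffOn_ax := contDiffOn_const.mul
    (contDiffOn_alphaX.comp (contDiff_rescale R).contDiffOn fun q hq => hq.1.1.1)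
  contDiffOn_ay := contDiffOn_const.mul
    (contDiffOn_alphaY.comp (contDiff_rescale R).contDiffOn fun q hq => hq.1.1.1)
  contDiffOn_c := by
    refine contDiffOn_const.mul (ContDiffOn.sqrt ?_ fun q hq => ?_)
    · have hα : ContDiffOn ℝ (⊤ : ℕ∞) (fun q => D.alpha (rescale R q))
          (rescale R ⁻¹' (D.merDom a₀ \ {((1 : ℝ), (0 : ℝ))})) :=
        contDiffOn_alpha.comp (contDiff_rescale R).contDiffOn fun q hq => hq.1.1.1
      refine D.contDiffOn_H.comp hα fun q hq => ?_
      simpa using abs_alpha_lt (D := D) hq.1.1.1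
    · exact (hH _ (alpha_pos hq.1.1.1 hq.2) hq.1.1.2).ne'
  bracket := fun q _ => by ring
  pde1 := fun q hq => by
    have hm : rescale R q ∈ D.locDom := hq.1.1.1
    have h := alpha_pde1 hm
    have hHpos : 0 < D.H (D.alpha (rescale R q)) := hH _ (alpha_pos hm hq.2) hq.1.1.2
    have hsq : Real.sqrt (D.H (D.alpha (rescale R q))) ^ 2 = D.H (D.alpha (rescale R q)) :=
      Real.sq_sqrt hHpos.le
    have hq1 : q.1 = R * (rescale R q).1 := by
      simp only [rescale]
      field_simp [hR.ne']
    rw [hq1]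
    linear_combination R ^ 6 * h + R ^ 6 * hsq
  pde3 := fun q hq => by
    have hm : rescale R q ∈ D.locDom := hq.1.1.1
    have h := alpha_pde3 hm
    have hq1 : q.1 = R * (rescale R q).1 := by
      simp only [rescale]
      field_simp [hR.ne']
    rw [hq1]
    linear_combination R ^ 6 * h

end ProfileData

/-! ### The germ near the circle and the theorem -/

section Assembly

open ProfileData AnsatzData

variable (D : ProfileData) {R a₀ : ℝ} (hR : 0 < R) (hH : ∀ a : ℝ, 0 < a → a < a₀ → 0 < D.H a)

include hR in
/-- The circle `𝒞_R` in meridian coordinates: `X ∈ 𝒞_R ↔ meridian X / R = (1, 0)`. [folklore] -/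
theorem mem_axisCircle_iff_rescale {X : EuclideanSpace ℝ (Fin 3)} :
    X ∈ axisCircle R ↔ rescale R (meridian X) = (1, 0) := by
  rw [mem_axisCircle, meridian_apply, rescale, Prod.mk.injEq]
  have hR' : R ≠ 0 := hR.ne'
  constructor
  · rintro ⟨h1, h2⟩
    rw [h1, h2]
    simp [hR']
  · rintro ⟨h1, h2⟩
    constructor
    · field_simp at h1
      linarith
    · simpa [hR'] using h2

include hR hH in
/-- **Gavrilov's theorem at radius `R`**: for every `δ > 0` a nonzero `C^∞` compactly
supported steady Euler flow supported in the `δ`-neighbourhood of `𝒞_R`, with all the printed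
structure (the `∃ U P` block of the named fact). [cite: Gavrilov2019, §1 Theorem and §3] -/
theorem exists_flow (ha₀pos : 0 < a₀) {δ : ℝ} (hδ : 0 < δ) :
    ∃ (U : EuclideanSpace ℝ (Fin 3) → EuclideanSpace ℝ (Fin 3)) (P : EuclideanSpace ℝ (Fin 3) → ℝ),
      ContDiff ℝ (⊤ : ℕ∞) U ∧ ContDiff ℝ (⊤ : ℕ∞) P ∧ HasCompactSupport U ∧ HasCompactSupport P ∧
      U ≠ 0 ∧ tsupport U ⊆ Metric.thickening δ {x | cylRadius x = R ∧ x 2 = 0} ∧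
      IsAxisymmetric U ∧ IsAxisymmetricScalar P ∧ ¬ HasNoSwirl U ∧
      VectorCalculus.IsDivFree U ∧ (∀ x, convect U U x + gradient P x = 0) ∧
      (∀ x, convect U P x = 0) := by
  set A : AnsatzData := D.ansatz hR hH with hA
  -- the open neighbourhood of the circle
  set W₀ : Set (ℝ × ℝ) := rescale R ⁻¹' D.merDom a₀ with hW₀
  set O : Set (EuclideanSpace ℝ (Fin 3)) := meridian ⁻¹' W₀ with hO
  have hmer : Continuous (meridian : EuclideanSpace ℝ (Fin 3) → ℝ × ℝ) :=
    continuous_cylRadius.prodMk (by fun_prop)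
  have hO_open : IsOpen O :=
    ((isOpen_merDom a₀).preimage (contDiff_rescale R (n := 0)).continuous).preimage hmer
  have hCO : axisCircle R ⊆ O := fun X hX => by
    show rescale R (meridian X) ∈ D.merDom a₀
    rw [(mem_axisCircle_iff_rescale hR).1 hX]
    exact one_zero_mem_merDom ha₀pos
  have htube : O \ axisCircle R = A.tube := by
    ext X
    simp [mem_axisCircle_iff_rescale hR, hO, hW₀, hA, ProfileData.ansatz, AnsatzData.tube]
  -- pressure on the circle and off it
  have hP_eq : ∀ X, A.P X = 4 * (R ^ 4 * D.alpha (rescale R (meridian X))) := fun X => rfl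
  refine exists_global_of_local hR hO_open hCO (u := A.U) (p := A.P) ?_ ?_ ?_ ?_ ?_ ?_ ?_ ?_ ?_ ?_ ?_ hδ
  · rw [htube]; exact contDiffOn_U
  · rw [htube]; exact contDiffOn_P
  · -- continuity of `P` on `O`
    have hα : ContinuousOn (fun X : EuclideanSpace ℝ (Fin 3) => D.alpha (rescale R (meridian X))) O :=
      continuousOn_alpha.comp ((contDiff_rescale R (n := 0)).continuous.comp hmer).continuousOn
        fun X hX => hX.1.1
    exact (continuousOn_const.mul (continuousOn_const.mul hα)).congr fun X _ => hP_eq X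
  · intro X hX
    rw [hP_eq, (mem_axisCircle_iff_rescale hR).1 hX, alpha_one_zero]
    ring
  · intro X hX
    rw [htube] at hX
    rw [hP_eq]
    have := alpha_pos hX.1.1.1 hX.2
    positivity
  · exact fun θ X _ => U_rotZ θ X
  · exact fun θ X _ => P_rotZ θ X
  · intro X hX
    rw [htube] at hX
    exact divergence_U hX
  · intro X hX
    rw [htube] at hX
    exact convect_U_add_gradient_P hX
  · intro X hX
    rw [htube] at hX
    exact fderiv_P_U hX
  · intro X hX
    rw [htube] at hX
    rw [swirl_U hX]
    show R ^ 3 * Real.sqrt (D.H (D.alpha (rescale R (meridian X)))) ≠ 0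
    have := hH _ (alpha_pos hX.1.1.1 hX.2) hX.1.1.2
    positivity

end Assembly

end Gavrilov

/-- **Gavrilov's theorem** (discharge of the named fact `gavrilov_compact_steady_euler`):
for every radius `R > 0` and every `δ > 0` there is a nonzero `C^∞` compactly supported steady
Euler flow on `ℝ³` supported in the `δ`-neighbourhood of the circle `{ρ = R, z = 0}`,
axisymmetric with nonzero swirl and compactly supported axisymmetric pressure, with
`div U = 0`, `(U·∇)U + ∇P = 0`, `U·∇P = 0`.  Proof: Lemma 1 (`GavrilovProfile`), Lemma 2 and
the chart (`GavrilovChart`), Lemma 3 (`GavrilovPotential`, `GavrilovLocalSolution`), Lemma 4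
(ibid.), the Lemma of §3 (`GavrilovAnsatz`) and the localisation (`GavrilovLocalisation`).
[cite: Gavrilov2019, §1 Theorem] -/
theorem gavrilov_compact_steady_euler_holds : gavrilov_compact_steady_euler := by
  intro R hR δ hδ
  obtain ⟨a₀, ha₀pos, hH⟩ := Gavrilov.exists_profileH_pos
  exact Gavrilov.exists_flow Gavrilov.gavrilovProfile hR hH ha₀pos hδ

end Literature.Analysis.FluidPDE
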